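import Mathlib
import Literature.MathematicalPhysics.QuantumLattice.FermiRG.Salmhofer1998Sec2
import HarnessLib

/-!
# Salmhofer 1998, Lemma 5 — toolkit II: integration by parts on the Brillouin torus in one
# coordinate, iterated; directional derivatives; bounded derivatives of periodic functions

M. Salmhofer, *Continuous renormalization for fermions and Fermi liquid theory*, Commun. Math. Phys.
**194** (1998) 249–295 = arXiv:cond-mat/9706188 [Salmhofer1998], §5.5, proof of Lemma 5: "(5.24) is
proven by the standard integration by parts method" (render `paper:arxiv-cond-mat_9706188` p.20 L92;
locators `p.N Ln` = chunk `pNNNN.txt` line `n`).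

Companion of the FROZEN statement file `Salmhofer1998Sec5.lean` (licence F-086 `DotCovarianceL1Bound`;
one proof-device `def`, no named fact, net debt `0`).  Content, for functions on `ℝ^d = Fin d → ℝ`:

* `dirDeriv v m G = (k ↦ ∂_v)^m G`, the `m`-fold directional derivative (iterate of `k ↦ DG(k)[v]`);
  smoothness bookkeeping (`contDiff_dirDeriv`), periodicity (`dirDeriv_periodic`), and the identity with
  the one-variable iterated derivative along the line `s ↦ k + s v` (`dirDeriv_apply_eq_iteratedDeriv`).
* **Integration by parts on the torus** (one coordinate `j`, box `∏ [-b,b)`, period `2b`): for `F ∈ C¹`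
  periodic in the coordinate `j`, `∫_box ∂_j F = 0` (`setIntegral_dirDeriv_eq_zero`; Fubini in the
  coordinate `j` via `MeasurableEquiv.piFinSuccAbove` and the fundamental theorem of calculus on the
  period); hence `x_j ∫_box e^{i𝐤·𝐱} G = i ∫_box e^{i𝐤·𝐱} ∂_j G` when `e^{2ib x_j} = 1`
  (`coord_mul_setIntegral_exp_mul`), and iterating, `x_j^m ∫_box e^{i𝐤·𝐱} G = i^m ∫_box e^{i𝐤·𝐱} ∂_j^m G`
  for `G ∈ C^m` (`coord_pow_mul_setIntegral_exp_mul`).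
* **Faà di Bruno along a line**: `‖∂_v^m (g ∘ E)(k)‖ ≤ m! C D^m` when `‖g^{(i)}‖ ≤ C` (`i ≤ m`) and
  `|∂_v^i E| ≤ D^i` (`1 ≤ i ≤ m`), from Mathlib's `norm_iteratedFDeriv_comp_le` in one variable
  (`norm_dirDeriv_comp_le`) — "derivatives with respect to `𝐩` can act on `E(𝐩)` or on `χ₁'`" (p.20 L10–13).
* A continuous function on `ℝ^d` periodic under a full lattice `(2π/ε)ℤ^d` is bounded
  (`exists_bound_of_periodic`), applied to the directional derivatives of the dispersion `E ∈ C^{k₀}`.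

No `instance`, no `notation`, no sorry/axiom; nothing about the Hubbard model is asserted or denied.
-/

noncomputable section

open Filter Function MeasureTheory Set
open scoped Topology ContDiff Nat

namespace Literature.MathematicalPhysics.QuantumLattice.FermiRG

namespace Salmhofer1998

/-! ### Directional derivatives, iterated -/

/-- `dirDeriv v m G = ∂_v^m G`, the `m`-th directional derivative of `G : ℝ^d → F` in the direction `v`
(the `m`-fold iterate of `G ↦ (k ↦ DG(k)[v])`). Proof device. [folklore] -/
def dirDeriv {d : ℕ} {F : Type*} [NormedAddCommGroup F] [NormedSpace ℝ F] (v : Fin d → ℝ) (m : ℕ)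
    (G : (Fin d → ℝ) → F) : (Fin d → ℝ) → F :=
  (fun (H : (Fin d → ℝ) → F) (k : Fin d → ℝ) => fderiv ℝ H k v)^[m] G

section Dir

variable {d : ℕ} {F : Type*} [NormedAddCommGroup F] [NormedSpace ℝ F] (v : Fin d → ℝ)

/-- `∂_v^0 G = G`. [cite: Salmhofer1998, Lemma 5 proof (p.20 L92)] -/
theorem dirDeriv_zero (G : (Fin d → ℝ) → F) : dirDeriv v 0 G = G := rfl

/-- `∂_v^{m+1} G = ∂_v^m (∂_v G)`. [cite: Salmhofer1998, Lemma 5 proof (p.20 L92)] -/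
theorem dirDeriv_succ (m : ℕ) (G : (Fin d → ℝ) → F) :
    dirDeriv v (m + 1) G = dirDeriv v m (fun k => fderiv ℝ G k v) := by
  unfold dirDeriv
  rw [Function.iterate_succ_apply]

/-- `∂_v^{m+1} G = ∂_v (∂_v^m G)`. [cite: Salmhofer1998, Lemma 5 proof (p.20 L92)] -/
theorem dirDeriv_succ' (m : ℕ) (G : (Fin d → ℝ) → F) :
    dirDeriv v (m + 1) G = fun k => fderiv ℝ (dirDeriv v m G) k v := by
  unfold dirDeriv
  rw [Function.iterate_succ_apply']

/-- `∂_v^1 G (k) = DG(k)[v]`. [cite: Salmhofer1998, Lemma 5 proof (p.20 L92)] -/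
theorem dirDeriv_one (G : (Fin d → ℝ) → F) (k : Fin d → ℝ) : dirDeriv v 1 G k = fderiv ℝ G k v := rfl

/-- `∂_v` lowers the differentiability degree by one. [cite: Salmhofer1998, Lemma 5 proof (p.20 L99–101)] -/
theorem contDiff_fderiv_apply_const {G : (Fin d → ℝ) → F} {m : ℕ} (hG : ContDiff ℝ (m + 1) G) :
    ContDiff ℝ m (fun k => fderiv ℝ G k v) :=
  (hG.fderiv_right (m := m) le_rfl).clm_apply contDiff_const

/-- `∂_v^i` maps `C^{m+i}` to `C^m`. [cite: Salmhofer1998, Lemma 5 proof (p.20 L99–101)] -/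
theorem contDiff_dirDeriv {m i : ℕ} :
    ∀ {G : (Fin d → ℝ) → F}, ContDiff ℝ (m + i) G → ContDiff ℝ m (dirDeriv v i G) := by
  induction i generalizing m with
  | zero => intro G hG; simpa [dirDeriv_zero] using hG
  | succ i ih =>
    intro G hG
    rw [dirDeriv_succ]
    apply ih
    apply contDiff_fderiv_apply_const
    have : ((m + (i + 1) : ℕ) : ℕ∞ω) = ((m + i + 1 : ℕ) : ℕ∞ω) := by push_cast; ring
    rw [← Nat.cast_add, this] at hG
    exact_mod_cast hG

/-- Periodicity is inherited by `∂_v G`. [cite: Salmhofer1998, Lemma 5 proof (p.20 L92)] -/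
theorem fderiv_apply_periodic {G : (Fin d → ℝ) → F} {c : Fin d → ℝ} (hper : ∀ k, G (k + c) = G k)
    (k : Fin d → ℝ) : fderiv ℝ G (k + c) v = fderiv ℝ G k v := by
  have h : (fun x => G (x + c)) = G := funext hper
  rw [← fderiv_comp_add_right c, h]

/-- Periodicity is inherited by `∂_v^m G`. [cite: Salmhofer1998, Lemma 5 proof (p.20 L92)] -/
theorem dirDeriv_periodic {m : ℕ} :
    ∀ {G : (Fin d → ℝ) → F} {c : Fin d → ℝ}, (∀ k, G (k + c) = G k) →
      ∀ k, dirDeriv v m G (k + c) = dirDeriv v m G k := by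
  induction m with
  | zero => intro G c hper k; simpa [dirDeriv_zero] using hper k
  | succ m ih =>
    intro G c hper k
    rw [dirDeriv_succ]
    exact ih (fun k => fderiv_apply_periodic v hper k) k

/-- The line derivative: `d/ds G(k + s v) = DG(k + s v)[v]`. [cite: Salmhofer1998, Lemma 5 proof (p.20 L92)] -/
theorem hasDerivAt_line {G : (Fin d → ℝ) → F} (hG : Differentiable ℝ G) (k : Fin d → ℝ) (s : ℝ) :
    HasDerivAt (fun s : ℝ => G (k + s • v)) (fderiv ℝ G (k + s • v) v) s := by
  have hl : HasDerivAt (fun s : ℝ => k + s • v) v s := by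
    have := ((hasDerivAt_id s).smul_const v).const_add k
    simpa using this
  have := (hG (k + s • v)).hasFDerivAt.comp_hasDerivAt s hl
  exact this

/-- **`∂_v^i G(k + s v) = (d/ds)^i [G(k + s v)]`** for `G ∈ C^m`, `i ≤ m`.
[cite: Salmhofer1998, Lemma 5 proof (p.20 L92)] -/
theorem dirDeriv_apply_eq_iteratedDeriv {m : ℕ} :
    ∀ {i : ℕ} {G : (Fin d → ℝ) → F}, ContDiff ℝ m G → i ≤ m → ∀ (k : Fin d → ℝ) (s : ℝ),
      dirDeriv v i G (k + s • v) = iteratedDeriv i (fun s : ℝ => G (k + s • v)) s := by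
  intro i
  induction i with
  | zero => intro G hG hi k s; simp [dirDeriv_zero]
  | succ i ih =>
    intro G hG hi k s
    rw [dirDeriv_succ', iteratedDeriv_succ]
    -- `∂_v^i G` is `C^{m-i}` with `m - i ≥ 1`, hence differentiable
    obtain ⟨r, hr⟩ : ∃ r, m = r + 1 + i := ⟨m - (i + 1), by omega⟩
    have hG' : ContDiff ℝ ((r + 1 + i : ℕ) : ℕ∞ω) G := by rw [← hr]; exact hG
    have hdi : ContDiff ℝ ((r + 1 : ℕ) : ℕ∞ω) (dirDeriv v i G) := by
      have := contDiff_dirDeriv v (m := r + 1) (i := i) (G := G) (by exact_mod_cast hG')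
      exact_mod_cast this
    have hdiff : Differentiable ℝ (dirDeriv v i G) := hdi.differentiable (by simp)
    have hline := hasDerivAt_line v hdiff k s
    beta_reduce
    rw [← hline.deriv]
    congr 1
    funext u
    exact ih hG (by omega) k u

end Dir

/-! ### Integration by parts on the torus, one coordinate -/

section Torus

variable {n : ℕ}

/-- The coordinate vector `e_j`. [cite: Salmhofer1998, Lemma 5 proof (p.20 L92)] -/
theorem norm_single_one_le (j : Fin (n + 1)) : ‖(Pi.single j (1 : ℝ) : Fin (n + 1) → ℝ)‖ ≤ 1 := by
  rw [pi_norm_le_iff_of_nonneg zero_le_one]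
  intro i
  by_cases h : i = j
  · subst h; simp
  · simp [h]

/-- Inserting the `j`-th coordinate is affine in that coordinate: `ins_j(s, k') = ins_j(0, k') + s e_j`.
[cite: Salmhofer1998, Lemma 5 proof (p.20 L92)] -/
theorem insertNth_eq_add_smul (j : Fin (n + 1)) (s : ℝ) (k' : Fin n → ℝ) :
    (Fin.insertNth j s k' : Fin (n + 1) → ℝ) =
      Fin.insertNth j (0 : ℝ) k' + s • (Pi.single j (1 : ℝ) : Fin (n + 1) → ℝ) := by
  ext i
  refine Fin.succAboveCases j ?_ (fun i' => ?_) i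
  · simp
  · simp [Fin.insertNth_apply_succAbove, Fin.succAbove_ne]

/-- The box `∏_{i} [-b, b)` is the preimage of `[-b,b) × ∏ [-b,b)` under "separate the `j`-th
coordinate". [cite: Salmhofer1998, Lemma 5 proof (p.20 L92)] -/
theorem pi_Ico_eq_preimage (j : Fin (n + 1)) (b : ℝ) :
    (Set.pi Set.univ fun _ : Fin (n + 1) => Set.Ico (-b) b) =
      (MeasurableEquiv.piFinSuccAbove (fun _ : Fin (n + 1) => ℝ) j) ⁻¹'
        (Set.Ico (-b) b ×ˢ Set.pi Set.univ fun _ : Fin n => Set.Ico (-b) b) := by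
  ext k
  simp only [Set.mem_pi, Set.mem_univ, true_implies, Set.mem_preimage, Set.mem_prod,
    MeasurableEquiv.piFinSuccAbove_apply]
  exact (Fin.forall_iff_succAbove j)

/-- **`∫_box ∂_j F = 0`** for `F ∈ C¹(ℝ^{n+1})` periodic with period `2b` in the coordinate `j`, the box
being `∏ [-b,b)`: Fubini in the coordinate `j` and the fundamental theorem of calculus over one period
(the boundary terms of the integration by parts cancel by periodicity).
[cite: Salmhofer1998, Lemma 5 proof (p.20 L92)] -/
theorem setIntegral_dirDeriv_eq_zero (j : Fin (n + 1)) {b : ℝ} (hb : 0 < b)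
    {F : (Fin (n + 1) → ℝ) → ℂ} (hF : ContDiff ℝ 1 F)
    (hper : ∀ k, F (k + (2 * b) • (Pi.single j (1 : ℝ) : Fin (n + 1) → ℝ)) = F k) :
    ∫ k in Set.pi Set.univ (fun _ : Fin (n + 1) => Set.Ico (-b) b),
      fderiv ℝ F k (Pi.single j (1 : ℝ)) = 0 := by
  set e := MeasurableEquiv.piFinSuccAbove (fun _ : Fin (n + 1) => ℝ) j with he
  set v : Fin (n + 1) → ℝ := Pi.single j (1 : ℝ) with hv
  set boxn : Set (Fin n → ℝ) := Set.pi Set.univ fun _ : Fin n => Set.Ico (-b) b with hboxn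
  have hmp : MeasurePreserving e volume volume :=
    volume_preserving_piFinSuccAbove (fun _ : Fin (n + 1) => ℝ) j
  -- the integrand as a function of the separated coordinates
  set Φ : ℝ × (Fin n → ℝ) → ℂ := fun p => fderiv ℝ F (e.symm p) v with hΦ
  have hcomp : (fun k : Fin (n + 1) → ℝ => fderiv ℝ F k v) = fun k => Φ (e k) := by
    funext k; simp [hΦ]
  rw [pi_Ico_eq_preimage j b, hcomp, hmp.setIntegral_preimage_emb e.measurableEmbedding]
  -- Fubini, inner integral over the separated coordinate
  have hΦcont : Continuous Φ := by
    have h1 : Continuous fun p : ℝ × (Fin n → ℝ) => (e.symm p : Fin (n + 1) → ℝ) := by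
      have : (fun p : ℝ × (Fin n → ℝ) => (e.symm p : Fin (n + 1) → ℝ)) =
          fun p => Fin.insertNth j p.1 p.2 := by
        funext p; rfl
      rw [this]
      exact Continuous.finInsertNth j continuous_fst continuous_snd
    exact ((hF.continuous_fderiv one_ne_zero).comp h1).clm_apply continuous_const
  have hInt : IntegrableOn Φ (Set.Ico (-b) b ×ˢ boxn) (volume.prod volume) := by
    have hK : IsCompact (Set.Icc (-b) b ×ˢ Set.pi Set.univ fun _ : Fin n => Set.Icc (-b) b) :=
      isCompact_Icc.prod (isCompact_univ_pi fun _ => isCompact_Icc)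
    refine (hΦcont.continuousOn.integrableOn_compact hK).mono_set ?_
    exact Set.prod_mono Set.Ico_subset_Icc_self (Set.pi_mono fun _ _ => Set.Ico_subset_Icc_self)
  have hmeas : (volume : Measure (ℝ × (Fin n → ℝ))).restrict (Set.Ico (-b) b ×ˢ boxn) =
      ((volume : Measure ℝ).restrict (Set.Ico (-b) b)).prod
        ((volume : Measure (Fin n → ℝ)).restrict boxn) := by
    rw [Measure.volume_eq_prod, Measure.prod_restrict]
  have hInt' : Integrable Φ (((volume : Measure ℝ).restrict (Set.Ico (-b) b)).prod
      ((volume : Measure (Fin n → ℝ)).restrict boxn)) := by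
    rw [Measure.prod_restrict]; exact hInt
  rw [hmeas, integral_prod_symm Φ hInt']
  -- the inner integral vanishes for every `k'`
  have hinner : ∀ k' : Fin n → ℝ, ∫ s in Set.Ico (-b) b, Φ (s, k') = 0 := by
    intro k'
    set k₀ : Fin (n + 1) → ℝ := Fin.insertNth j (0 : ℝ) k' with hk₀
    have hsymm : ∀ s : ℝ, (e.symm (s, k') : Fin (n + 1) → ℝ) = k₀ + s • v := by
      intro s
      have : (e.symm (s, k') : Fin (n + 1) → ℝ) = Fin.insertNth j s k' := rfl
      rw [this, insertNth_eq_add_smul]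
    have hΦs : ∀ s : ℝ, Φ (s, k') = fderiv ℝ F (k₀ + s • v) v := by
      intro s; simp only [hΦ, hsymm]
    simp_rw [hΦs]
    rw [integral_Ico_eq_integral_Ioc, ← intervalIntegral.integral_of_le (by linarith)]
    have hderiv : ∀ s ∈ Set.uIcc (-b) b,
        HasDerivAt (fun s : ℝ => F (k₀ + s • v)) (fderiv ℝ F (k₀ + s • v) v) s :=
      fun s _ => hasDerivAt_line v (hF.differentiable one_ne_zero) k₀ s
    have hint : IntervalIntegrable (fun s : ℝ => fderiv ℝ F (k₀ + s • v) v) volume (-b) b := by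
      apply Continuous.intervalIntegrable
      exact ((hF.continuous_fderiv one_ne_zero).comp (continuous_const.add
        (continuous_id.smul continuous_const))).clm_apply continuous_const
    rw [intervalIntegral.integral_eq_sub_of_hasDerivAt hderiv hint]
    have hshift : k₀ + b • v = (k₀ + (-b) • v) + (2 * b) • v := by
      rw [add_assoc, ← add_smul]; ring_nf
    rw [hshift, hper, sub_self]
  simp_rw [hinner]
  simp

/-- `‖e^{i θ}‖ = 1` for real `θ`. [cite: Salmhofer1998, Lemma 5 proof (p.20 L70–75)] -/
theorem norm_exp_I_mul_real (θ : ℝ) : ‖Complex.exp (Complex.I * (θ : ℂ))‖ = 1 := by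
  rw [mul_comm, Complex.norm_exp_ofReal_mul_I]

/-- The phase `𝐤 ↦ e^{i𝐤·𝐱}` is smooth. [cite: Salmhofer1998, Lemma 5 proof (p.20 L70–75)] -/
theorem contDiff_phase (x : Fin (n + 1) → ℝ) {N : ℕ∞ω} :
    ContDiff ℝ N fun k : Fin (n + 1) → ℝ => Complex.exp (Complex.I * ((∑ i, k i * x i : ℝ) : ℂ)) := by
  have h1 : ContDiff ℝ N fun k : Fin (n + 1) → ℝ => (∑ i, k i * x i : ℝ) :=
    ContDiff.sum fun i _ => (contDiff_apply ℝ ℝ i).mul contDiff_const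
  have h2 : ContDiff ℝ N fun k : Fin (n + 1) → ℝ => ((∑ i, k i * x i : ℝ) : ℂ) :=
    Complex.ofRealCLM.contDiff.comp h1
  exact Complex.contDiff_exp.comp (contDiff_const.mul h2)

/-- The derivative of the phase in the direction `e_j` is `i x_j e^{i𝐤·𝐱}`.
[cite: Salmhofer1998, Lemma 5 proof (p.20 L92)] -/
theorem fderiv_phase_apply (x : Fin (n + 1) → ℝ) (j : Fin (n + 1)) (k : Fin (n + 1) → ℝ) :
    fderiv ℝ (fun k : Fin (n + 1) → ℝ => Complex.exp (Complex.I * ((∑ i, k i * x i : ℝ) : ℂ))) k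
        (Pi.single j (1 : ℝ)) =
      Complex.I * (x j : ℂ) * Complex.exp (Complex.I * ((∑ i, k i * x i : ℝ) : ℂ)) := by
  -- compute along the line `s ↦ k + s e_j`
  have hd : Differentiable ℝ
      (fun k : Fin (n + 1) → ℝ => Complex.exp (Complex.I * ((∑ i, k i * x i : ℝ) : ℂ))) :=
    (contDiff_phase x (N := 1)).differentiable one_ne_zero
  have hline := hasDerivAt_line (Pi.single j (1 : ℝ)) hd k 0
  simp only [zero_smul, add_zero] at hline
  -- the line function is `s ↦ e^{i(θ₀ + s x_j)}`
  have hsum : ∀ s : ℝ, (∑ i, (k + s • (Pi.single j (1 : ℝ) : Fin (n + 1) → ℝ)) i * x i : ℝ) =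
      (∑ i, k i * x i) + s * x j := by
    intro s
    simp only [Pi.add_apply, Pi.smul_apply, smul_eq_mul, add_mul, Finset.sum_add_distrib]
    congr 1
    rw [Finset.sum_eq_single j]
    · simp
    · intro i _ hi; simp [hi]
    · intro h; exact absurd (Finset.mem_univ j) h
  have hline2 : HasDerivAt (fun s : ℝ =>
      Complex.exp (Complex.I * (((∑ i, k i * x i) + s * x j : ℝ) : ℂ)))
      (Complex.I * (x j : ℂ) * Complex.exp (Complex.I * ((∑ i, k i * x i : ℝ) : ℂ))) 0 := by
    have h1 : HasDerivAt (fun s : ℝ => Complex.I * (((∑ i, k i * x i) + s * x j : ℝ) : ℂ))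
        (Complex.I * (x j : ℂ)) 0 := by
      have h0 : HasDerivAt (fun s : ℝ => (((∑ i, k i * x i) + s * x j : ℝ) : ℂ)) ((x j : ℝ) : ℂ) 0 := by
        have hr : HasDerivAt (fun s : ℝ => (∑ i, k i * x i) + s * x j) (x j) 0 := by
          have := ((hasDerivAt_id (0 : ℝ)).mul_const (x j)).const_add (∑ i, k i * x i)
          simpa using this
        exact hr.ofReal_comp
      have := h0.const_mul Complex.I
      simpa using this
    have := h1.cexp
    simp only [zero_mul, add_zero] at this
    convert this using 1
    ring
  have hfun : (fun s : ℝ => Complex.exp (Complex.I *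
      ((∑ i, (k + s • (Pi.single j (1 : ℝ) : Fin (n + 1) → ℝ)) i * x i : ℝ) : ℂ))) =
      fun s : ℝ => Complex.exp (Complex.I * (((∑ i, k i * x i) + s * x j : ℝ) : ℂ)) := by
    funext s; rw [hsum]
  rw [hfun] at hline
  exact hline.unique hline2

/-- **Integration by parts in the coordinate `j`**: for `G ∈ C¹(ℝ^{n+1})` periodic with period `2b` in
the coordinate `j` and `𝐱` with `e^{2ib x_j} = 1` (for the Brillouin zone `b = π/ε` and `𝐱 ∈ εℤ^d`):
`x_j ∫_box e^{i𝐤·𝐱} G(𝐤) d𝐤 = i ∫_box e^{i𝐤·𝐱} ∂_j G(𝐤) d𝐤`. [cite: Salmhofer1998, Lemma 5 proof (p.20 L92)] -/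
theorem coord_mul_setIntegral_exp_mul (j : Fin (n + 1)) {b : ℝ} (hb : 0 < b)
    {G : (Fin (n + 1) → ℝ) → ℂ} (hG : ContDiff ℝ 1 G)
    (hper : ∀ k, G (k + (2 * b) • (Pi.single j (1 : ℝ) : Fin (n + 1) → ℝ)) = G k)
    (x : Fin (n + 1) → ℝ) (hx : Complex.exp (Complex.I * ((2 * b * x j : ℝ) : ℂ)) = 1) :
    (x j : ℂ) * ∫ k in Set.pi Set.univ (fun _ : Fin (n + 1) => Set.Ico (-b) b),
        Complex.exp (Complex.I * ((∑ i, k i * x i : ℝ) : ℂ)) * G k =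
      Complex.I * ∫ k in Set.pi Set.univ (fun _ : Fin (n + 1) => Set.Ico (-b) b),
        Complex.exp (Complex.I * ((∑ i, k i * x i : ℝ) : ℂ)) * fderiv ℝ G k (Pi.single j (1 : ℝ)) := by
  set v : Fin (n + 1) → ℝ := Pi.single j (1 : ℝ) with hv
  set ph : (Fin (n + 1) → ℝ) → ℂ := fun k => Complex.exp (Complex.I * ((∑ i, k i * x i : ℝ) : ℂ))
    with hph
  -- apply `∫ ∂_j F = 0` to `F = e^{i𝐤·𝐱} G`
  have hF : ContDiff ℝ 1 (fun k => ph k * G k) := (contDiff_phase x).mul hG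
  have hphper : ∀ k, ph (k + (2 * b) • v) = ph k := by
    intro k
    simp only [hph]
    have hsum : (∑ i, (k + (2 * b) • v) i * x i : ℝ) = (∑ i, k i * x i) + 2 * b * x j := by
      simp only [Pi.add_apply, Pi.smul_apply, smul_eq_mul, add_mul, Finset.sum_add_distrib, hv]
      congr 1
      rw [Finset.sum_eq_single j]
      · simp
      · intro i _ hi; simp [hi]
      · intro h; exact absurd (Finset.mem_univ j) h
    rw [hsum]
    push_cast
    rw [mul_add, Complex.exp_add]
    have : Complex.exp (Complex.I * (2 * (b : ℂ) * (x j : ℂ))) = 1 := by exact_mod_cast hx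
    rw [this, mul_one]
  have hFper : ∀ k, ph (k + (2 * b) • v) * G (k + (2 * b) • v) = ph k * G k := by
    intro k; rw [hphper, hper]
  have hzero := setIntegral_dirDeriv_eq_zero j hb hF hFper
  -- product rule inside the integral
  have hprod : ∀ k, fderiv ℝ (fun k => ph k * G k) k v =
      Complex.I * (x j : ℂ) * ph k * G k + ph k * fderiv ℝ G k v := by
    intro k
    have hdph : DifferentiableAt ℝ ph k := ((contDiff_phase x (N := 1)).differentiable one_ne_zero) k
    have hdG : DifferentiableAt ℝ G k := (hG.differentiable one_ne_zero) k
    rw [fderiv_fun_mul hdph hdG]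
    simp only [add_apply, smul_apply, smul_eq_mul]
    rw [hph, fderiv_phase_apply x j k]
    ring
  rw [← hv] at hzero
  simp_rw [hprod] at hzero
  -- split the integral
  have hbox : IsCompact (Set.pi Set.univ fun _ : Fin (n + 1) => Set.Icc (-b) b) :=
    isCompact_univ_pi fun _ => isCompact_Icc
  have hsub : (Set.pi Set.univ fun _ : Fin (n + 1) => Set.Ico (-b) b) ⊆
      Set.pi Set.univ fun _ : Fin (n + 1) => Set.Icc (-b) b :=
    Set.pi_mono fun _ _ => Set.Ico_subset_Icc_self
  have hphc : Continuous ph := (contDiff_phase x (N := 0)).continuous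
  have hi1 : IntegrableOn (fun k => Complex.I * (x j : ℂ) * ph k * G k)
      (Set.pi Set.univ fun _ : Fin (n + 1) => Set.Ico (-b) b) := by
    refine (ContinuousOn.integrableOn_compact hbox ?_).mono_set hsub
    exact ((continuous_const.mul hphc).mul hG.continuous).continuousOn
  have hi2 : IntegrableOn (fun k => ph k * fderiv ℝ G k v)
      (Set.pi Set.univ fun _ : Fin (n + 1) => Set.Ico (-b) b) := by
    refine (ContinuousOn.integrableOn_compact hbox ?_).mono_set hsub
    exact (hphc.mul ((hG.continuous_fderiv one_ne_zero).clm_apply continuous_const)).continuousOn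
  rw [integral_add hi1 hi2] at hzero
  have hI1 : ∫ k in Set.pi Set.univ (fun _ : Fin (n + 1) => Set.Ico (-b) b),
      Complex.I * (x j : ℂ) * ph k * G k =
      Complex.I * (x j : ℂ) * ∫ k in Set.pi Set.univ (fun _ : Fin (n + 1) => Set.Ico (-b) b),
        ph k * G k := by
    rw [← integral_const_mul]
    congr 1; funext k; ring
  rw [hI1] at hzero
  -- `I x_j A + B = 0` ⇒ `x_j A = I B`
  have hA : (∫ k in Set.pi Set.univ (fun _ : Fin (n + 1) => Set.Ico (-b) b),
      Complex.exp (Complex.I * ((∑ i, k i * x i : ℝ) : ℂ)) * G k) =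
      ∫ k in Set.pi Set.univ (fun _ : Fin (n + 1) => Set.Ico (-b) b), ph k * G k := by
    simp only [hph]
  have hB : (∫ k in Set.pi Set.univ (fun _ : Fin (n + 1) => Set.Ico (-b) b),
      Complex.exp (Complex.I * ((∑ i, k i * x i : ℝ) : ℂ)) * fderiv ℝ G k (Pi.single j (1 : ℝ))) =
      ∫ k in Set.pi Set.univ (fun _ : Fin (n + 1) => Set.Ico (-b) b), ph k * fderiv ℝ G k v := by
    simp only [hph, hv]
  rw [hA, hB]
  linear_combination (-Complex.I) * hzero +
    ((x j : ℂ) * ∫ k in Set.pi Set.univ (fun _ : Fin (n + 1) => Set.Ico (-b) b), ph k * G k) *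
      Complex.I_sq

/-- **Iterated integration by parts in the coordinate `j`**: for `G ∈ C^m(ℝ^{n+1})` periodic with period
`2b` in the coordinate `j` and `e^{2ib x_j} = 1`,
`x_j^m ∫_box e^{i𝐤·𝐱} G(𝐤) d𝐤 = i^m ∫_box e^{i𝐤·𝐱} ∂_j^m G(𝐤) d𝐤` — `k₀ > d` such steps give the decay
`(1 + ε_t|𝐱|)^{-k₀}` of (5.24). [cite: Salmhofer1998, Lemma 5 proof (5.24)–(5.25) (p.20 L84–104)] -/
theorem coord_pow_mul_setIntegral_exp_mul (j : Fin (n + 1)) {b : ℝ} (hb : 0 < b) (x : Fin (n + 1) → ℝ)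
    (hx : Complex.exp (Complex.I * ((2 * b * x j : ℝ) : ℂ)) = 1) {m : ℕ} :
    ∀ {G : (Fin (n + 1) → ℝ) → ℂ}, ContDiff ℝ m G →
      (∀ k, G (k + (2 * b) • (Pi.single j (1 : ℝ) : Fin (n + 1) → ℝ)) = G k) →
      (x j : ℂ) ^ m * ∫ k in Set.pi Set.univ (fun _ : Fin (n + 1) => Set.Ico (-b) b),
          Complex.exp (Complex.I * ((∑ i, k i * x i : ℝ) : ℂ)) * G k =
        Complex.I ^ m * ∫ k in Set.pi Set.univ (fun _ : Fin (n + 1) => Set.Ico (-b) b),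
          Complex.exp (Complex.I * ((∑ i, k i * x i : ℝ) : ℂ)) *
            dirDeriv (Pi.single j (1 : ℝ)) m G k := by
  induction m with
  | zero => intro G hG hper; simp [dirDeriv_zero]
  | succ m ih =>
    intro G hG hper
    have hG1 : ContDiff ℝ 1 G := hG.of_le (by exact_mod_cast Nat.le_add_left 1 m)
    have hGm : ContDiff ℝ m (fun k => fderiv ℝ G k (Pi.single j (1 : ℝ))) :=
      contDiff_fderiv_apply_const _ (by exact_mod_cast hG)
    have hper' : ∀ k, fderiv ℝ G (k + (2 * b) • (Pi.single j (1 : ℝ) : Fin (n + 1) → ℝ))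
        (Pi.single j (1 : ℝ)) = fderiv ℝ G k (Pi.single j (1 : ℝ)) :=
      fun k => fderiv_apply_periodic _ hper k
    have step := coord_mul_setIntegral_exp_mul j hb hG1 hper x hx
    have hih := ih hGm hper'
    rw [dirDeriv_succ]
    linear_combination (x j : ℂ) ^ m * step + Complex.I * hih

/-- `‖∫_box e^{i𝐤·𝐱} H(𝐤) d𝐤‖ ≤ ∫_box ‖H(𝐤)‖ d𝐤`. [cite: Salmhofer1998, Lemma 5 proof (p.20 L84–90)] -/
theorem norm_setIntegral_exp_mul_le (x : Fin (n + 1) → ℝ) (H : (Fin (n + 1) → ℝ) → ℂ)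
    (s : Set (Fin (n + 1) → ℝ)) :
    ‖∫ k in s, Complex.exp (Complex.I * ((∑ i, k i * x i : ℝ) : ℂ)) * H k‖ ≤ ∫ k in s, ‖H k‖ := by
  refine (norm_integral_le_integral_norm _).trans (le_of_eq ?_)
  congr 1
  funext k
  rw [norm_mul, norm_exp_I_mul_real, one_mul]

end Torus

/-! ### Faà di Bruno along a line; supports -/

section Compose

variable {d : ℕ}

/-- **"Derivatives with respect to `𝐩` can act on `E(𝐩)` or on `χ₁'`"**: if `‖g^{(i)}‖ ≤ C` for
`i ≤ m` and `|∂_v^i E| ≤ D^i` for `1 ≤ i ≤ m`, then `‖∂_v^m (g ∘ E)‖ ≤ m!·C·D^m` (Faà di Bruno's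
formula in one variable along the line `s ↦ k + sv`, via Mathlib's `norm_iteratedFDeriv_comp_le`).
[cite: Salmhofer1998, Lemma 4 proof (p.20 L10–13); Lemma 5 proof (5.25) (p.20 L99–104)] -/
theorem norm_dirDeriv_comp_le {g : ℝ → ℂ} {E : (Fin d → ℝ) → ℝ} {m : ℕ} (hg : ContDiff ℝ m g)
    (hE : ContDiff ℝ m E) (v : Fin d → ℝ) {C D : ℝ}
    (hC : ∀ i, i ≤ m → ∀ y : ℝ, ‖iteratedDeriv i g y‖ ≤ C)
    (hD : ∀ i, 1 ≤ i → i ≤ m → ∀ k : Fin d → ℝ, ‖dirDeriv v i E k‖ ≤ D ^ i) (k : Fin d → ℝ) :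
    ‖dirDeriv v m (fun k => g (E k)) k‖ ≤ m ! * C * D ^ m := by
  have hGm : ContDiff ℝ m (fun k => g (E k)) := hg.comp hE
  have h0 : dirDeriv v m (fun k => g (E k)) k =
      iteratedDeriv m (fun s : ℝ => g (E (k + s • v))) 0 := by
    have := dirDeriv_apply_eq_iteratedDeriv v hGm le_rfl k 0
    simpa using this
  set ln : ℝ → ℝ := fun s => E (k + s • v) with hln
  have hlnm : ContDiff ℝ m ln := hE.comp (contDiff_const.add (contDiff_id.smul contDiff_const))
  have hcomp : (fun s : ℝ => g (E (k + s • v))) = g ∘ ln := rfl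
  rw [h0, hcomp, ← norm_iteratedFDeriv_eq_norm_iteratedDeriv]
  refine norm_iteratedFDeriv_comp_le hg hlnm le_rfl 0 ?_ ?_
  · intro i hi
    rw [norm_iteratedFDeriv_eq_norm_iteratedDeriv]
    exact hC i hi _
  · intro i hi1 hi2
    rw [norm_iteratedFDeriv_eq_norm_iteratedDeriv]
    have := dirDeriv_apply_eq_iteratedDeriv v hE hi2 k 0
    simp only [zero_smul, add_zero] at this
    rw [hln, ← this]
    exact hD i hi1 hi2 k

/-- If `f` vanishes near `k`, so do all its directional derivatives.
[cite: Salmhofer1998, Lemma 5 proof (5.25) (p.20 L101–104)] -/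
theorem dirDeriv_eventuallyEq_zero {F : Type*} [NormedAddCommGroup F] [NormedSpace ℝ F]
    (v : Fin d → ℝ) {m : ℕ} :
    ∀ {f : (Fin d → ℝ) → F} {k : Fin d → ℝ}, f =ᶠ[𝓝 k] (fun _ => 0) →
      dirDeriv v m f =ᶠ[𝓝 k] fun _ => 0 := by
  induction m with
  | zero => intro f k hf; simpa [dirDeriv_zero] using hf
  | succ m ih =>
    intro f k hf
    rw [dirDeriv_succ]
    apply ih
    have hnear : ∀ᶠ k' in 𝓝 k, f =ᶠ[𝓝 k'] fun _ => (0 : F) := hf.eventually_nhds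
    filter_upwards [hnear] with k' hk'
    rw [hk'.fderiv_eq]
    simp

/-- **Support**: if `g(y) = 0` for `|y| > ε` and `|E(k)| > ε`, then `∂_v^m (g ∘ E)(k) = 0` — the factor
`1(|E(𝐤)| ≤ ε_t)` in (5.25). [cite: Salmhofer1998, Lemma 5 proof (5.25) (p.20 L101–104)] -/
theorem dirDeriv_comp_eq_zero {g : ℝ → ℂ} {E : (Fin d → ℝ) → ℝ} (hE : Continuous E) {ε : ℝ}
    (hg : ∀ y : ℝ, ε < |y| → g y = 0) (v : Fin d → ℝ) (m : ℕ) {k : Fin d → ℝ} (hk : ε < |E k|) :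
    dirDeriv v m (fun k => g (E k)) k = 0 := by
  have hev : (fun k => g (E k)) =ᶠ[𝓝 k] fun _ => (0 : ℂ) := by
    have hopen : ∀ᶠ k' in 𝓝 k, ε < |E k'| :=
      (continuous_abs.comp hE).continuousAt.eventually_const_lt hk
    filter_upwards [hopen] with k' hk'
    exact hg _ hk'
  exact (dirDeriv_eventuallyEq_zero v hev).eq_of_nhds

end Compose

/-! ### Continuous periodic functions on `ℝ^d` are bounded; derivatives of the dispersion relation -/

section Periodic

variable {d : ℕ}

/-- A continuous function on `ℝ^d` that is periodic under the lattice `Pℤ^d` is bounded (its values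
are values on the compact cell `[0,P]^d`). [cite: Salmhofer1998, §2.3 (p.6 L142–157)] -/
theorem exists_bound_of_periodic {F : Type*} [NormedAddCommGroup F] {f : (Fin d → ℝ) → F}
    (hf : Continuous f) {P : ℝ} (hP : 0 < P)
    (hper : ∀ (k : Fin d → ℝ) (z : Fin d → ℤ), f (k + fun i => P * (z i : ℝ)) = f k) :
    ∃ C : ℝ, 0 ≤ C ∧ ∀ k : Fin d → ℝ, ‖f k‖ ≤ C := by
  have hK : IsCompact (Set.pi Set.univ fun _ : Fin d => Set.Icc (0 : ℝ) P) :=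
    isCompact_univ_pi fun _ => isCompact_Icc
  obtain ⟨C, hC⟩ := hK.exists_bound_of_continuousOn hf.continuousOn
  refine ⟨max C 0, le_max_right _ _, fun k => ?_⟩
  -- reduce `k` to the cell
  set z : Fin d → ℤ := fun i => ⌊k i / P⌋ with hz
  set k₀ : Fin d → ℝ := fun i => k i - P * (z i : ℝ) with hk₀
  have hk : k = k₀ + fun i => P * (z i : ℝ) := by
    funext i; simp [hk₀]
  have hmem : k₀ ∈ Set.pi Set.univ fun _ : Fin d => Set.Icc (0 : ℝ) P := by
    simp only [Set.mem_pi, Set.mem_univ, true_implies, Set.mem_Icc, hk₀, hz]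
    intro i
    constructor
    · have := Int.sub_floor_div_mul_nonneg (k i) hP
      linarith [mul_comm P (⌊k i / P⌋ : ℝ)]
    · have := Int.sub_floor_div_mul_lt (k i) hP
      linarith [mul_comm P (⌊k i / P⌋ : ℝ)]
  rw [hk, hper]
  exact (hC k₀ hmem).trans (le_max_left _ _)

/-- **Uniform bounds on the directional derivatives of the dispersion relation**: for `E ∈ C^N(ℝ^d)`
periodic under `Pℤ^d` there is `D ≥ 1` with `|∂_j^i E(k)| ≤ D` (hence `≤ D^i`) for all coordinates `j`,
all `1 ≤ i ≤ N` and all `k` — the "factors bounded by `ε_t⁻¹|∇E(𝐩)|`", etc., of the printed proof are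
finite because `E ∈ C^{k₀}` is periodic. [cite: Salmhofer1998, §2.3 (p.6 L144–157); Lemma 4 proof (p.20 L10–13)] -/
theorem exists_bound_dirDeriv_periodic {E : (Fin d → ℝ) → ℝ} {N : ℕ} (hE : ContDiff ℝ N E) {P : ℝ}
    (hP : 0 < P) (hper : ∀ (k : Fin d → ℝ) (z : Fin d → ℤ), E (k + fun i => P * (z i : ℝ)) = E k) :
    ∃ D : ℝ, 1 ≤ D ∧ ∀ (j : Fin d) (i : ℕ), 1 ≤ i → i ≤ N → ∀ k : Fin d → ℝ,
      ‖dirDeriv (Pi.single j (1 : ℝ)) i E k‖ ≤ D ^ i := by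
  -- each `∂_j^i E`, `i ≤ N`, is continuous and periodic, hence bounded
  have hb : ∀ (j : Fin d) (i : ℕ), i ≤ N → ∃ C : ℝ, 0 ≤ C ∧ ∀ k,
      ‖dirDeriv (Pi.single j (1 : ℝ)) i E k‖ ≤ C := by
    intro j i hi
    obtain ⟨r, hr⟩ : ∃ r, N = r + i := ⟨N - i, by omega⟩
    have hEi : ContDiff ℝ ((r + i : ℕ) : ℕ∞ω) E := by rw [← hr]; exact hE
    have hcont : Continuous (dirDeriv (Pi.single j (1 : ℝ)) i E) := by
      have h := contDiff_dirDeriv (Pi.single j (1 : ℝ)) (m := r) (i := i) (G := E)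
        (by exact_mod_cast hEi)
      exact h.continuous
    exact exists_bound_of_periodic hcont hP
      (fun k z => dirDeriv_periodic (Pi.single j (1 : ℝ)) (fun k => hper k z) k)
  classical
  choose! C hC0 hC using hb
  refine ⟨1 + ∑ j : Fin d, ∑ i ∈ Finset.range (N + 1), C j i, ?_, ?_⟩
  · have : 0 ≤ ∑ j : Fin d, ∑ i ∈ Finset.range (N + 1), C j i :=
      Finset.sum_nonneg fun j _ => Finset.sum_nonneg fun i hi =>
        hC0 j i (Nat.lt_succ_iff.mp (Finset.mem_range.mp hi))
    linarith
  · intro j i hi1 hi2 k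
    have hle : C j i ≤ ∑ j' : Fin d, ∑ i' ∈ Finset.range (N + 1), C j' i' := by
      have h1 : C j i ≤ ∑ i' ∈ Finset.range (N + 1), C j i' :=
        Finset.single_le_sum (fun i' hi' => hC0 j i' (Nat.lt_succ_iff.mp (Finset.mem_range.mp hi')))
          (Finset.mem_range.mpr (Nat.lt_succ_of_le hi2))
      refine h1.trans ?_
      exact Finset.single_le_sum (f := fun j' => ∑ i' ∈ Finset.range (N + 1), C j' i')
        (fun j' _ => Finset.sum_nonneg fun i' hi' =>
          hC0 j' i' (Nat.lt_succ_iff.mp (Finset.mem_range.mp hi'))) (Finset.mem_univ j)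
    have hD1 : (1 : ℝ) ≤ 1 + ∑ j' : Fin d, ∑ i' ∈ Finset.range (N + 1), C j' i' := by
      have : 0 ≤ ∑ j' : Fin d, ∑ i' ∈ Finset.range (N + 1), C j' i' :=
        Finset.sum_nonneg fun j _ => Finset.sum_nonneg fun i hi =>
          hC0 j i (Nat.lt_succ_iff.mp (Finset.mem_range.mp hi))
      linarith
    calc ‖dirDeriv (Pi.single j (1 : ℝ)) i E k‖ ≤ C j i := hC j i hi2 k
      _ ≤ 1 + ∑ j' : Fin d, ∑ i' ∈ Finset.range (N + 1), C j' i' := by linarith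
      _ ≤ (1 + ∑ j' : Fin d, ∑ i' ∈ Finset.range (N + 1), C j' i') ^ i :=
          le_self_pow₀ hD1 (by omega)

end Periodic

end Salmhofer1998

end Literature.MathematicalPhysics.QuantumLattice.FermiRG
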